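import Summits.HodgeConjecture.HodgeConjecture.Theorems.EightfoldBlochSeedsChernCharacterOnBettiAnalytificationFlagBundle
import Literature.AlgebraicGeometry.HodgeTheory.ProjectiveBundleTautologicalQuotientProof
import HarnessLib

/-!
# K1 — the cycle law `ch_k(F(ℂ)) ∈ algebraicClasses X k` for EVERY vector bundle, UNCONDITIONALLY

Route `EightfoldBlochSeeds` / item `stmt-HodgeConjecture-19780` (`ChernCharacterOnBetti`), helper (`--supports`).
HONEST FRAMING: nothing here proves 19780 / 18880 / 18882 / 18883 / H2 / HC_AV / HC_CM / HC; no definition, no named fact.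

★ `…AnalytificationFlagBundle` (p829323) proved the cycle law for every vector bundle on a smooth projective complex variety
GRANTED the named fact `FlagBundleSplitting`. That fact is now a tree THEOREM (★
`HodgeTheory/ProjectiveBundleTautologicalQuotientProof.flagBundleSplitting_holds`, via the incidence model of the projective bundle
`P(G) ⊂ X × Gr₁`, `Motives/ProjectiveBundleOfQuotient*`), so the three statements hold unconditionally:
`topologicalChernCharacter_mem_algebraicClasses_of_comparison'`, `chernClassIn_complex_mem_algebraicClasses_of_comparison'`,
`exists_analytification_topologicalChernCharacter_mem_algebraicClasses'`.

[cite: Grothendieck1958, §2] [cite: Fulton1998, §3.2 and Prop. 19.1.2] [cite: Hartshorne1977, II §7 Prop. 7.10–7.12]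
[cite: VoisinHodgeI2002, §7.3.2 Lemma 7.28 and Remark 7.29] [cite: SerreGAGA1956, §3 n°9 Prop. 10 and n°11]
-/

noncomputable section

-- single-problem summit (Problem = Summit): the mandated namespace repeats `HodgeConjecture`.
set_option linter.dupNamespace false

open CategoryTheory AlgebraicGeometry Bundle Topology
open Literature.AlgebraicGeometry.Motives Literature.AlgebraicGeometry.HodgeTheory Literature.AlgebraicGeometry.Modules
open Literature.AlgebraicTopology.SingularHomology Literature.AlgebraicTopology.CharacteristicClasses

namespace Summit.HodgeConjecture.HodgeConjecture.Theorems

variable {n : ℕ} {X : SchemeOver ℂ} {F : X.left.Modules} {r : ℕ}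

/-- **`ch_k(F(ℂ)) ∈ algebraicClasses X k` for EVERY vector bundle `F` on a smooth projective complex `X`**, for every
analytification datum `(E, α)` of `F` and every `k` — UNCONDITIONAL (★ `flagBundleSplitting_holds`).
[cite: Grothendieck1958, §2] [cite: Fulton1998, §3.2 and Prop. 19.1.2] [cite: Hartshorne1977, II §7 Prop. 7.11] -/
theorem topologicalChernCharacter_mem_algebraicClasses_of_comparison'
    (hX : IsSmoothProjective n X) (hF : IsVectorBundle F)
    (hFr : ∀ x : X.left, ∃ (U : X.left.Opens) (s : Fin r → Γ(F, U)), x ∈ U ∧ IsSectionFrame F U s)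
    (E : ComplexVectorBundle.{0, 0} (ComplexPoints X))
    (α : ∀ U : X.left.Opens, Γ(F, U) → ∀ P : ComplexPoints X, E.E P)
    (hadd : ∀ (U : X.left.Opens) (σ τ : Γ(F, U)) (P : ComplexPoints X), α U (σ + τ) P = α U σ P + α U τ P)
    (hsmul : ∀ (U : X.left.Opens) (f : Γ(X.left, U)) (σ : Γ(F, U)) (P : ComplexPoints X) (h : P.pt ∈ U),
      α U (f • σ) P = P.eval U h f • α U σ P)
    (hres : ∀ (U W : X.left.Opens) (hWU : W ≤ U) (σ : Γ(F, U)) (P : ComplexPoints X), P.pt ∈ W →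
      α W (F.presheaf.map (homOfLE hWU).op σ) P = α U σ P)
    (hcont : ∀ (U : X.left.Opens) (σ : Γ(F, U)),
      ContinuousOn (fun P ↦ (⟨P, α U σ P⟩ : TotalSpace E.F E.E)) {P | P.pt ∈ U})
    (hframe : ∀ (U : X.left.Opens) (t : Fin r → Γ(F, U)), IsSectionFrame F U t →
      ∀ P : ComplexPoints X, P.pt ∈ U → LinearIndependent ℂ (fun j ↦ α U (t j) P) ∧
        ⊤ ≤ Submodule.span ℂ (Set.range fun j ↦ α U (t j) P)) (k : ℕ) :
    theChernClassTheory.topologicalChernCharacter ℂ E k ∈ algebraicClasses X k :=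
  topologicalChernCharacter_mem_algebraicClasses_of_comparison flagBundleSplitting_holds hX hF hFr E α hadd hsmul hres
    hcont hframe k

/-- **`cᵢ(F(ℂ))_ℂ ∈ algebraicClasses X i` for EVERY vector bundle `F` on a smooth projective complex `X`** — UNCONDITIONAL.
[cite: Grothendieck1958, §2] [cite: Fulton1998, §3.2 and Prop. 19.1.2] [cite: Hartshorne1977, II §7 Prop. 7.11] -/
theorem chernClassIn_complex_mem_algebraicClasses_of_comparison'
    (hX : IsSmoothProjective n X) (hF : IsVectorBundle F)
    (hFr : ∀ x : X.left, ∃ (U : X.left.Opens) (s : Fin r → Γ(F, U)), x ∈ U ∧ IsSectionFrame F U s)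
    (E : ComplexVectorBundle.{0, 0} (ComplexPoints X))
    (α : ∀ U : X.left.Opens, Γ(F, U) → ∀ P : ComplexPoints X, E.E P)
    (hadd : ∀ (U : X.left.Opens) (σ τ : Γ(F, U)) (P : ComplexPoints X), α U (σ + τ) P = α U σ P + α U τ P)
    (hsmul : ∀ (U : X.left.Opens) (f : Γ(X.left, U)) (σ : Γ(F, U)) (P : ComplexPoints X) (h : P.pt ∈ U),
      α U (f • σ) P = P.eval U h f • α U σ P)
    (hres : ∀ (U W : X.left.Opens) (hWU : W ≤ U) (σ : Γ(F, U)) (P : ComplexPoints X), P.pt ∈ W →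
      α W (F.presheaf.map (homOfLE hWU).op σ) P = α U σ P)
    (hcont : ∀ (U : X.left.Opens) (σ : Γ(F, U)),
      ContinuousOn (fun P ↦ (⟨P, α U σ P⟩ : TotalSpace E.F E.E)) {P | P.pt ∈ U})
    (hframe : ∀ (U : X.left.Opens) (t : Fin r → Γ(F, U)), IsSectionFrame F U t →
      ∀ P : ComplexPoints X, P.pt ∈ U → LinearIndependent ℂ (fun j ↦ α U (t j) P) ∧
        ⊤ ≤ Submodule.span ℂ (Set.range fun j ↦ α U (t j) P)) (i : ℕ) :
    theChernClassTheory.chernClassIn ℂ E i ∈ algebraicClasses X i :=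
  chernClassIn_complex_mem_algebraicClasses_of_comparison flagBundleSplitting_holds hX hF hFr E α hadd hsmul hres hcont
    hframe i

/-- **Every vector bundle on a smooth projective complex variety has a topological analytification all of whose Chern character
components and complexified Chern classes are algebraic classes** — UNCONDITIONAL. [cite: SerreGAGA1956, §3 n°9 Prop. 10 and §4 n°20]
[cite: Grothendieck1958, §2] [cite: Fulton1998, §3.2 and Prop. 19.1.2] -/
theorem exists_analytification_topologicalChernCharacter_mem_algebraicClasses'
    (hX : IsSmoothProjective n X) (hF : IsVectorBundle F) :
    ∃ (r : ℕ) (E : ComplexVectorBundle.{0, 0} (ComplexPoints X))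
      (α : ∀ U : X.left.Opens, Γ(F, U) → ∀ P : ComplexPoints X, E.E P),
      E.rank = r ∧
      (∀ x : X.left, ∃ (U : X.left.Opens) (s : Fin r → Γ(F, U)), x ∈ U ∧ IsSectionFrame F U s) ∧
      (∀ (U : X.left.Opens) (σ τ : Γ(F, U)) (P : ComplexPoints X),
          α U (σ + τ) P = α U σ P + α U τ P) ∧
      (∀ (U : X.left.Opens) (f : Γ(X.left, U)) (σ : Γ(F, U)) (P : ComplexPoints X) (h : P.pt ∈ U),
          α U (f • σ) P = P.eval U h f • α U σ P) ∧
      (∀ (U W : X.left.Opens) (hWU : W ≤ U) (σ : Γ(F, U)) (P : ComplexPoints X), P.pt ∈ W →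
          α W (F.presheaf.map (homOfLE hWU).op σ) P = α U σ P) ∧
      (∀ (U : X.left.Opens) (σ : Γ(F, U)),
          ContinuousOn (fun P ↦ (⟨P, α U σ P⟩ : TotalSpace E.F E.E)) {P | P.pt ∈ U}) ∧
      (∀ (U : X.left.Opens) (t : Fin r → Γ(F, U)), IsSectionFrame F U t → ∀ P : ComplexPoints X,
          P.pt ∈ U → LinearIndependent ℂ (fun j ↦ α U (t j) P) ∧
            ⊤ ≤ Submodule.span ℂ (Set.range fun j ↦ α U (t j) P)) ∧
      (∀ k : ℕ, theChernClassTheory.topologicalChernCharacter ℂ E k ∈ algebraicClasses X k) ∧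
      (∀ i : ℕ, theChernClassTheory.chernClassIn ℂ E i ∈ algebraicClasses X i) :=
  exists_analytification_topologicalChernCharacter_mem_algebraicClasses flagBundleSplitting_holds hX hF

end Summit.HodgeConjecture.HodgeConjecture.Theorems

end
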